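import Summits.ABC.ABC.Theses.FeketeScales
import Literature.NumberTheory.DiophantineGeometry.AbcPrimePowerFamily
import HarnessLib

/-!
# Route FeketeScales — crux `SparseGoodScales` (stmt-ABC-2161): the WINDOWED residue WGS forces
# `liminf = 0 ∨ limsup = 1` for `log rad(q^n − 1)/(n log q)` (rate floors, general form)

Helper file (`--supports stmt-ABC-2161`, lead seat c11), companion of
`FeketeScalesSparseGoodScalesRateFloor.lean` (DA∃ excludes every EXACT intermediate rate) and
`FeketeScalesSparseGoodScalesRadicalLimsup.lean` (the crux forces `limsup = 1`).  Here the general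
two-rate form, stated for the WINDOWED-form matrix `c ≤ R^{1+δ}` (weaker than DA's
`c ≤ rad^{1+δ}`, so the floor is stronger):

* `sparseGoodScales_windowedDroughts_false_of_radical_rates` — if `0 < α ≤ β < 1` and
  `q^{(α−ε)n} ≤ rad(q^n − 1) ≤ q^{(β+ε)n}` for every `ε > 0` and all large `n`, then for every
  ratio `Λ` with `Λ α > β` only boundedly many scales `R` can have the property "every abc triple
  with `rad ≤ R < rad^Λ` has `c ≤ R^{1+δ}`", `δ = (1−β)/2`: the triples `(1, q^n − 1, q^n)` have
  quality `≥ 1/(β+o(1))` and radicals in `[q^{(α−o(1))n}, q^{(β+o(1))n}]`, dense in ratio `Λ`;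
* `sparseGoodScales_windowed_imp_liminf_zero_or_limsup_one` — hence **WGS (all ratios `Λ > 1`; the
  registered stub signature of line `Sketch` verbatim) ⟹ for every prime `q` and all
  `0 < α ≤ β < 1` the two-sided law fails**, i.e. `liminf_n log rad(q^n − 1)/(n log q) = 0` or
  `limsup_n = 1` (take `Λ = β/α + 1`).

So, in one currency `x_n(q) := log rad(q^n − 1)/(n log q)` (abc: `x_n → 1`; unconditionally not
even `limsup x_n > 0` is known, for any `q`):  crux ⟹ `limsup = 1`;  WGS ⟹ `liminf = 0 ∨
limsup = 1`;  DA∃ ⟹ `x_n` converges to no `γ ∈ (0,1)` — three open floors of decreasing strength,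
matching `SGS ⟹ WGS ⟹ DA∃`.  In-route all three stubs are abc-equivalent given the vertical stub.
-/

-- `Summit.<Summit>.<Problem>` is the mandated summit-side namespace (CONVENTIONS §2); for the
-- single-conjunct summit `ABC` the two coincide, so the duplicate `ABC.ABC` is deliberate.
set_option linter.dupNamespace false

noncomputable section

namespace Summit.ABC.ABC.Theorems

open Literature.NumberTheory.DiophantineGeometry UniqueFactorizationMonoid
open Summit.ABC.ABC.Theses.FeketeScales

/-- **Two radical rates `α ≤ β < 1` with `Λ α > β` refute windowed droughts of ratio `Λ` at
`δ = (1−β)/2`.**  Proof: take `ε ≤ (1−β)/8` with `ε(Λ+1) ≤ (Λα − β)/2`; at a large scale `R = q^x`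
put `n = ⌊(x−1)/(β+ε)⌋`: the triple `(1, q^n − 1, q^n)` has `rad ≤ q^{(β+ε)n+1} ≤ R`,
`rad^Λ ≥ q^{Λ((α−ε)n+1)} > q^x = R`, and `R^{1+δ} = q^{x(1+δ)} < q^n = c` because
`x < (β+ε)n + 2` and `(1+δ)(β+ε) ≤ 1 − 3(1−β)/8`. [folklore] -/
theorem sparseGoodScales_windowedDroughts_false_of_radical_rates {q : ℕ} (hq : q.Prime) {α β : ℝ}
    (hα0 : 0 < α) (hαβ : α ≤ β) (hβ1 : β < 1)
    (hH : ∀ ε : ℝ, 0 < ε → ∃ n₀ : ℕ, ∀ n : ℕ, n₀ ≤ n →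
      (q : ℝ) ^ ((α - ε) * n) ≤ ((radical (q ^ n - 1) : ℕ) : ℝ) ∧
        ((radical (q ^ n - 1) : ℕ) : ℝ) ≤ (q : ℝ) ^ ((β + ε) * n))
    {Λ : ℝ} (hΛ : β < Λ * α)
    (hdr : ∀ N : ℕ, ∃ R : ℕ, N ≤ R ∧ ∀ a b c : ℕ, IsABCTriple a b c → rad a b c ≤ R →
      (R : ℝ) < ((rad a b c : ℕ) : ℝ) ^ Λ → (c : ℝ) ≤ (R : ℝ) ^ (1 + (1 - β) / 2)) :
    False := by
  -- parameters
  set δ : ℝ := (1 - β) / 2 with hδ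
  set u : ℝ := 1 - β with hu
  have hu0 : 0 < u := by rw [hu]; linarith
  have hu1 : u < 1 := by rw [hu]; linarith
  set ε₁ : ℝ := (1 - β) / 8 with hε₁
  have hε₁0 : 0 < ε₁ := by rw [hε₁]; linarith
  have hΛ1 : 1 < Λ := by
    by_contra hle
    push Not at hle
    have : Λ * α ≤ 1 * α := mul_le_mul_of_nonneg_right hle hα0.le
    linarith
  have hΛ0 : 0 < Λ := by linarith
  have hslack : 0 < Λ * α - β := by linarith
  set ε : ℝ := min ε₁ ((Λ * α - β) / (2 * (Λ + 1))) with hε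
  have hεpos' : 0 < (Λ * α - β) / (2 * (Λ + 1)) := div_pos hslack (by linarith)
  have hε0 : 0 < ε := lt_min hε₁0 hεpos'
  have hεε₁ : ε ≤ ε₁ := min_le_left _ _
  have hεΛ' : ε ≤ (Λ * α - β) / (2 * (Λ + 1)) := min_le_right _ _
  -- `ε (Λ + 1) ≤ (Λ α − β)/2` and `ε < α / 2`
  have hεΛ : ε * (Λ + 1) ≤ (Λ * α - β) / 2 := by
    have h1 : ε * (Λ + 1) ≤ (Λ * α - β) / (2 * (Λ + 1)) * (Λ + 1) :=
      mul_le_mul_of_nonneg_right hεΛ' (by linarith)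
    have h2 : (Λ * α - β) / (2 * (Λ + 1)) * (Λ + 1) = (Λ * α - β) / 2 := by
      field_simp
    linarith
  have hεα : ε < α / 2 := by
    -- `Λ α − β ≤ Λ α − α = α (Λ − 1) < α (Λ + 1)`
    have h1 : (Λ * α - β) / (2 * (Λ + 1)) < α / 2 := by
      rw [div_lt_iff₀ (by linarith : (0 : ℝ) < 2 * (Λ + 1))]
      linarith
    linarith
  set cp : ℝ := β + ε with hcp
  set cm : ℝ := α - ε with hcm
  have hcp0 : 0 < cp := by rw [hcp]; linarith
  have hcp1 : cp < 1 := by rw [hcp, hε₁] at *; linarith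
  have hcm0 : 0 < cm := by rw [hcm]; linarith
  have hcpε₁ : cp ≤ β + ε₁ := by rw [hcp]; linarith
  -- the window slack `A = Λ cm − cp > 0`
  have hA : 0 < Λ * cm - cp := by
    rw [hcm, hcp]
    linarith
  -- thresholds on `n`
  obtain ⟨n₀, hn₀⟩ := hH ε hε0
  obtain ⟨n₁, hn₁⟩ := exists_nat_gt (8 / u)
  obtain ⟨n₂, hn₂⟩ := exists_nat_gt ((cp + 1) / (Λ * cm - cp))
  set nt : ℕ := max (max n₀ n₁) (max n₂ 1) with hnt
  -- threshold on the scale: `x ≥ X₀ := 1 + cp (nt + 1)`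
  set X₀ : ℝ := 1 + cp * (nt + 1) with hX₀
  have hq1 : (1 : ℝ) < q := by exact_mod_cast hq.one_lt
  have hq0 : (0 : ℝ) < q := by linarith
  obtain ⟨N₁, hN₁⟩ := exists_nat_gt ((q : ℝ) ^ X₀)
  obtain ⟨R, hRN, hgood⟩ := hdr N₁
  -- `R = q^x`, `x ≥ X₀`
  have hR0 : (0 : ℝ) < R := by
    have : (q : ℝ) ^ X₀ < R := lt_of_lt_of_le hN₁ (by exact_mod_cast hRN)
    exact lt_trans (Real.rpow_pos_of_pos hq0 _) this
  set x : ℝ := Real.logb q R with hx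
  have hqx : (q : ℝ) ^ x = R := by rw [hx]; exact Real.rpow_logb hq0 hq1.ne' hR0
  have hxX : X₀ ≤ x := by
    rw [hx, Real.le_logb_iff_rpow_le hq1 hR0]
    exact le_of_lt (lt_of_lt_of_le hN₁ (by exact_mod_cast hRN))
  have hX1 : 1 ≤ X₀ := by
    rw [hX₀]
    have : (0 : ℝ) ≤ cp * (nt + 1) := mul_nonneg hcp0.le (by positivity)
    linarith
  -- `n := ⌊(x − 1)/cp⌋`
  have hy0 : 0 ≤ (x - 1) / cp := div_nonneg (by linarith) hcp0.le
  set n : ℕ := ⌊(x - 1) / cp⌋₊ with hn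
  have hn_le : (n : ℝ) ≤ (x - 1) / cp := Nat.floor_le hy0
  have hn_gt : (x - 1) / cp < n + 1 := Nat.lt_floor_add_one _
  have hnt1 : nt + 1 ≤ n := by
    rw [hn]
    apply Nat.le_floor
    push_cast
    rw [le_div_iff₀ hcp0]
    have : X₀ - 1 = cp * (nt + 1) := by rw [hX₀]; ring
    linarith
  have hn0' : n₀ ≤ n := by omega
  have hn1' : n₁ ≤ n := by omega
  have hn2' : n₂ ≤ n := by omega
  have hnone : 1 ≤ n := by omega
  have hnR : (0 : ℝ) ≤ n := by positivity
  -- two-sided radical bounds at `n`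
  obtain ⟨hlow, hupp⟩ := hn₀ n hn0'
  set r : ℝ := ((radical (q ^ n - 1) : ℕ) : ℝ) with hr
  have hr0 : 0 < r := by
    rw [hr]; exact_mod_cast Nat.radical_pos _
  -- the triple `(1, q^n − 1, q^n)` and its radical `r · q`
  have htri : IsABCTriple 1 (q ^ n - 1) (q ^ n) := isABCTriple_one_pow_sub_one hq.two_le hnone
  have hradT : ((rad 1 (q ^ n - 1) (q ^ n) : ℕ) : ℝ) = r * q := by
    rw [rad_one_pow_sub_one_pow hq hnone, hr]; push_cast; ring
  -- upper: `rad ≤ q^{cp n + 1} ≤ q^x = R`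
  have hup1 : r * q ≤ (q : ℝ) ^ (cp * n + 1) := by
    rw [Real.rpow_add hq0, Real.rpow_one]
    exact mul_le_mul_of_nonneg_right hupp hq0.le
  have hcpn : cp * n + 1 ≤ x := by
    have := mul_le_mul_of_nonneg_left hn_le hcp0.le
    rw [mul_div_cancel₀ _ hcp0.ne'] at this
    linarith
  have hradR : ((rad 1 (q ^ n - 1) (q ^ n) : ℕ) : ℝ) ≤ (R : ℝ) := by
    rw [hradT, ← hqx]
    exact le_trans hup1 (Real.rpow_le_rpow_of_exponent_le hq1.le hcpn)
  have hradRn : rad 1 (q ^ n - 1) (q ^ n) ≤ R := by exact_mod_cast hradR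
  -- window: `R < rad^Λ`, from `rad ≥ q^{cm n + 1}` and `Λ (cm n + 1) > x`
  have hlow1 : (q : ℝ) ^ (cm * n + 1) ≤ r * q := by
    rw [Real.rpow_add hq0, Real.rpow_one]
    exact mul_le_mul_of_nonneg_right hlow hq0.le
  have hexp : x < Λ * (cm * n + 1) := by
    -- `x < cp (n + 1) + 1` and `(Λ cm − cp) n > cp + 1`
    have h1 : x - 1 < cp * (n + 1) := by
      have := (div_lt_iff₀ hcp0).mp hn_gt
      linarith
    have h2 : (cp + 1) / (Λ * cm - cp) < n := lt_of_lt_of_le hn₂ (by exact_mod_cast hn2')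
    have h3 : cp + 1 < (Λ * cm - cp) * n := by
      rw [div_lt_iff₀ hA] at h2; linarith
    linarith
  have hwin : (R : ℝ) < ((rad 1 (q ^ n - 1) (q ^ n) : ℕ) : ℝ) ^ Λ := by
    have hpos : (0 : ℝ) < (q : ℝ) ^ (cm * n + 1) := Real.rpow_pos_of_pos hq0 _
    calc (R : ℝ) = (q : ℝ) ^ x := hqx.symm
      _ < (q : ℝ) ^ (Λ * (cm * n + 1)) := Real.rpow_lt_rpow_of_exponent_lt hq1 hexp
      _ = ((q : ℝ) ^ (cm * n + 1)) ^ Λ := by rw [mul_comm, Real.rpow_mul hq0.le]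
      _ ≤ (r * q) ^ Λ := Real.rpow_le_rpow hpos.le hlow1 hΛ0.le
      _ = ((rad 1 (q ^ n - 1) (q ^ n) : ℕ) : ℝ) ^ Λ := by rw [hradT]
  -- the windowed-drought property at `R` bounds `c = q^n` by `R^{1+δ} = q^{x(1+δ)}`
  have hc := hgood 1 (q ^ n - 1) (q ^ n) htri hradRn hwin
  have hc' : (q : ℝ) ^ (n : ℝ) ≤ (q : ℝ) ^ (x * (1 + δ)) := by
    have e1 : ((q ^ n : ℕ) : ℝ) = (q : ℝ) ^ (n : ℝ) := by push_cast; rw [Real.rpow_natCast]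
    have e2 : (R : ℝ) ^ (1 + δ) = (q : ℝ) ^ (x * (1 + δ)) := by rw [← hqx, ← Real.rpow_mul hq0.le]
    rw [← e1, ← e2]; exact hc
  -- but `x (1 + δ) < n`: `x < cp n + cp + 1 ≤ cp n + 2` and `(1+δ)(cp n + 2) ≤ (1 − 3u/8) n + 3`
  have hδ0 : 0 < 1 + δ := by rw [hδ]; linarith
  have hkey : x * (1 + δ) < n := by
    have hun : 8 < u * n := by
      have h1 : 8 / u < n := lt_of_lt_of_le hn₁ (by exact_mod_cast hn1')
      rw [div_lt_iff₀ hu0] at h1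
      linarith
    have hu2n : 0 ≤ u ^ 2 * n := by positivity
    have hcpu : cp ≤ 1 - 7 * u / 8 := by
      have h' := hcpε₁
      rw [hε₁] at h'
      linarith
    have hx2 : x < cp * n + 2 := by
      have := (div_lt_iff₀ hcp0).mp hn_gt
      linarith
    have hδpos : 0 ≤ 1 + δ := hδ0.le
    have hstep1 : x * (1 + δ) ≤ (cp * n + 2) * (1 + δ) :=
      mul_le_mul_of_nonneg_right hx2.le hδpos
    have hprod : (1 + δ) * (cp * n) ≤ (1 + δ) * ((1 - 7 * u / 8) * n) :=
      mul_le_mul_of_nonneg_left (mul_le_mul_of_nonneg_right hcpu hnR) hδpos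
    have h1 : (cp * n + 2) * (1 + δ) ≤ (1 + δ) * ((1 - 7 * u / 8) * n) + 2 * (1 + δ) := by
      linarith
    have h2 : (1 + δ) * ((1 - 7 * u / 8) * n) + 2 * (1 + δ) < n := by
      rw [hδ]
      linarith
    linarith
  have hlt : (q : ℝ) ^ (x * (1 + δ)) < (q : ℝ) ^ (n : ℝ) :=
    Real.rpow_lt_rpow_of_exponent_lt hq1 hkey
  linarith

/-- **WGS forces `liminf = 0 ∨ limsup = 1` for `log rad(q^n − 1)/(n log q)`, every prime `q`.**
The horizontal stub WGS of line `Sketch` (windowed good scales for every `δ > 0` and EVERY ratio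
`Λ > 1`; hypothesis = its registered signature verbatim) implies that for every prime `q` and all
`0 < α ≤ β < 1` it is NOT the case that `q^{(α−ε)n} ≤ rad(q^n − 1) ≤ q^{(β+ε)n}` for every
`ε > 0` and all large `n` (use `δ = (1−β)/2` and the ratio `Λ = β/α + 1`).  abc gives `lim = 1`;
unconditionally no such two-sided law is excluded.  (The statement is kept on one line: it is the
signature registered on stmt-ABC-2161 for this sub-goal.) [folklore] -/
theorem sparseGoodScales_windowed_imp_liminf_zero_or_limsup_one : (∀ δ : ℝ, 0 < δ → ∀ Λ : ℝ, 1 < Λ → ∀ N : ℕ, ∃ R : ℕ, N ≤ R ∧ ∀ a b c : ℕ, Literature.NumberTheory.DiophantineGeometry.IsABCTriple a b c → Literature.NumberTheory.DiophantineGeometry.rad a b c ≤ R → (R : ℝ) < ((Literature.NumberTheory.DiophantineGeometry.rad a b c : ℕ) : ℝ) ^ Λ → (c : ℝ) ≤ (R : ℝ) ^ (1 + δ)) → ∀ q : ℕ, q.Prime → ∀ α β : ℝ, 0 < α → α ≤ β → β < 1 → ¬ (∀ ε : ℝ, 0 < ε → ∃ n₀ : ℕ, ∀ n : ℕ, n₀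 ≤ n → (q : ℝ) ^ ((α - ε) * n) ≤ ((UniqueFactorizationMonoid.radical (q ^ n - 1) : ℕ) : ℝ) ∧ ((UniqueFactorizationMonoid.radical (q ^ n - 1) : ℕ) : ℝ) ≤ (q : ℝ) ^ ((β + ε) * n)) := by
  intro hW q hq α β hα0 hαβ hβ1 hH
  have hδ0 : (0 : ℝ) < (1 - β) / 2 := by linarith
  set Λ : ℝ := β / α + 1 with hΛ
  have hΛ1 : 1 < Λ := by
    rw [hΛ]
    have : 0 < β / α := div_pos (by linarith) hα0
    linarith
  have hΛα : β < Λ * α := by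
    rw [hΛ, add_mul, one_mul, div_mul_cancel₀ _ hα0.ne']
    linarith
  exact sparseGoodScales_windowedDroughts_false_of_radical_rates hq hα0 hαβ hβ1 hH hΛα
    (hW ((1 - β) / 2) hδ0 Λ hΛ1)

end Summit.ABC.ABC.Theorems

end
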